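import Literature.NumberTheory.GaloisRepresentations.IdeleClassHerbrand
import Literature.NumberTheory.GaloisRepresentations.CyclicNormIndex
import Mathlib.NumberTheory.NumberField.Completion.Ramification
import HarnessLib

/-!
# Galois descent for ideles and the idelic global cyclic norm index (Childress Thm. 5.11 ⇒ 5.12)

Topic `NumberTheory/GaloisRepresentations` (class field theory: Childress, *Class Field Theory*,
Ch. 4 §5, PDF pp. 101–103); namespace
`Literature.NumberTheory.GaloisRepresentations.IdeleHerbrand`.  Everything **proved**, with the
same two inline hypotheses as `IdeleClassHerbrand.lean` (`hun₀`/`hun₁`: Prop. 5.7 (iii);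
`hunits`: Prop. 5.10).

* **Galois descent** `IdeleHerbrand.exists_ideleBaseChange_eq_of_forall_smul_eq`:
  `J_E^G = J_F` — an idele of `E` fixed by `Gal(E/F)` is the base change of an idele of `F`
  (finite places: a `G`-fixed element of `∏_{w∣v} E_w = E ⊗_F F_v` has constant coordinates in
  the normal basis, `SemiLocal.exists_eq_algebraMap_of_forall_smul_eq`; infinite places:
  `[E_w : F_v] = #G_w` and the non-trivial element of `G_w` moves `E_w`,
  `ArchHerbrand.exists_eq_completionMap_of_forall_smul_eq`).
* **Hilbert 90 for idele classes** `IdeleHerbrand.z0_top_principalIdeles_eq`: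
  `{x ∈ J_E : σx/x ∈ Eˣ} = J_F · Eˣ` (Hilbert 90 for `Eˣ`, `CyclicNormIndex`, plus descent).
* **`#Ĥ⁰(G; J_E, Eˣ) = [J_F : Fˣ N_{E/F} J_E]`** (`IdeleHerbrand.h0_top_principalIdeles_eq_index_normGroup`)
  and hence, with Thm. 5.11 (`IdeleClassHerbrand.lean`), the **idelic global cyclic norm index
  identity** `IdeleHerbrand.card_dvd_index_normGroup`:
  `[E : F] ∣ [J_F : Fˣ N_{E/F} J_E]` and `[J_F : Fˣ N_{E/F} J_E] ≠ 0` — in particular the first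
  inequality `[J_F : Fˣ N J_E] ≥ [E : F]` for cyclic `E/F` (Childress Thm. 5.12 in idelic form,
  cf. Ch. 7 Thm. 4.6), for the norm group `Automorphic.normGroup F E` of `ClassFieldCharacter.lean`.

## References

* N. Childress, *Class Field Theory*, Universitext, Springer 2009, Ch. 4 §5 Thm. 5.11–5.12
  (PDF pp. 101–103). [Childress2009]
* J. W. S. Cassels, A. Fröhlich (eds.), *Algebraic Number Theory* (1967), Ch. VII (Tate) §5.1,
  §9 (first inequality). [CasselsFrohlichANT1967]
-/

noncomputable section

open NumberField IsDedekindDomain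
open scoped Valued

namespace Literature.NumberTheory.GaloisRepresentations

universe u

/-! ### Descent at the finite places: `(∏_{w ∣ v} E_w)^G = F_v` -/

namespace SemiLocal

open Literature.NumberTheory.Automorphic

variable {F : Type u} [Field F] [NumberField F] {E : Type u} [Field E] [NumberField E] [Algebra F E]
variable {v : HeightOneSpectrum (𝓞 F)} [IsGalois F E]

/-- **`G`-fixed elements of `∏_{w ∣ v} E_w` come from `F_v`**: in the normal basis `(b_g)_g`
(`σ • b_g = b_{σg}`) a fixed element has constant coordinates, hence is a multiple of
`∑_g b_g = Tr(α) ∈ F_v`. [cite: CasselsFrohlichANT1967, Ch. VII §1.1] -/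
theorem exists_eq_algebraMap_of_forall_smul_eq (x : SemiLocal F E v) (hx : ∀ σ : E ≃ₐ[F] E, σ • x = x) :
    ∃ c : v.adicCompletion F, algebraMap (v.adicCompletion F) (SemiLocal F E v) c = x := by
  classical
  set b := basis F E v with hbdef
  -- coordinates are permuted by the action
  have hrepr : ∀ σ g : E ≃ₐ[F] E, b.repr x (σ * g) = b.repr x g := by
    intro σ g
    have hx' : σ • x = ∑ h, b.repr x h • b (σ * h) := by
      conv_lhs => rw [← b.sum_repr x, Finset.smul_sum]
      refine Finset.sum_congr rfl fun h _ => ?_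
      rw [smul_comm, hbdef, smul_basis]
    have : b.repr (σ • x) (σ * g) = b.repr x (σ * g) := by rw [hx σ]
    rw [← this, hx', map_sum]
    simp only [map_smul, Finsupp.coe_finsetSum, Finsupp.coe_smul, Finset.sum_apply, Pi.smul_apply,
      Module.Basis.repr_self, smul_eq_mul]
    rw [Finset.sum_eq_single g]
    · rw [Finsupp.single_eq_same, mul_one]
    · intro h _ hne
      rw [Finsupp.single_eq_of_ne (fun heq => hne (mul_left_cancel heq).symm), mul_zero]
    · intro h; exact absurd (Finset.mem_univ g) h
  have hconst : ∀ g : E ≃ₐ[F] E, b.repr x g = b.repr x 1 := fun g => by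
    have := hrepr g 1; rwa [mul_one] at this
  refine ⟨b.repr x 1 * (Algebra.trace F E (IsGalois.normalBasis F E 1) : v.adicCompletion F), ?_⟩
  rw [map_mul, ← sum_basis_eq, ← hbdef, Finset.mul_sum]
  conv_rhs => rw [← b.sum_repr x]
  refine Finset.sum_congr rfl fun g _ => ?_
  rw [hconst g, Algebra.smul_def]

end SemiLocal

/-! ### Descent at the infinite places: `E_w^{G_w} = F_v` -/

namespace ArchHerbrand

open NumberField.InfinitePlace Literature.NumberTheory.Automorphic
open scoped NumberField.LiesOver

variable {F : Type*} [Field F] {E : Type*} [Field E] [Algebra F E]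

/-- **`G_w`-fixed elements of `E_w` come from `F_v`** (`v = w|_F`): if `w/v` is unramified,
`[E_w : F_v] = 1`; if ramified, `[E_w : F_v] = 2` and the non-trivial `c ∈ G_w` acts non-trivially
(as complex conjugation), so its fixed subspace is the line `F_v`.
[cite: CasselsFrohlichANT1967, Ch. VII §1.1] -/
theorem exists_eq_completionMap_of_forall_smul_eq [NumberField F] [NumberField E] [IsGalois F E]
    (v : InfinitePlace F) (w : InfinitePlace E) [i : w.1.LiesOver v.1] (y : w.Completion)
    (hy : ∀ (σ : E ≃ₐ[F] E) (h : σ • w = w), galInfiniteCompletionMap σ h y = y) :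
    ∃ c : v.Completion, NumberField.LiesOver.completionMap (v := v) (w := w) c = y := by
  by_cases hur : w.IsUnramified F
  · -- dimension one
    have h1 := InfinitePlace.Completion.finrank_eq_one_of_isUnramified v hur
    obtain ⟨c, hc⟩ := (finrank_eq_one_iff_of_nonzero' (1 : w.Completion) one_ne_zero).mp h1 y
    exact ⟨c, by rw [← hc, Algebra.smul_def, mul_one]; rfl⟩
  · -- dimension two, `c` acts non-trivially
    have hram : w.IsRamified F := hur
    have h2 := InfinitePlace.Completion.finrank_eq_two_of_isRamified v hram
    obtain ⟨c, hconj⟩ := exists_isConj_of_isRamified (φ := w.embedding) (by rwa [mk_embedding])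
    have hc1 : c ≠ 1 := by
      rintro rfl
      rw [ComplexEmbedding.isConj_one_iff] at hconj
      exact (isComplex_iff.mp (isRamified_iff.mp hram).1) hconj
    have hcw : c • w = w := by
      have : c ∈ MulAction.stabilizer (E ≃ₐ[F] E) (InfinitePlace.mk w.embedding) :=
        (mem_stabilizer_mk_iff _ c).mpr (Or.inr hconj)
      rwa [mk_embedding] at this
    -- `c_w` as an `F_v`-linear map
    haveI : FiniteDimensional v.Completion w.Completion := Module.finite_of_finrank_eq_succ h2
    let f : w.Completion →ₗ[v.Completion] w.Completion :=
      { toFun := galInfiniteCompletionMap c hcw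
        map_add' := map_add _
        map_smul' := fun a z => by
          rw [RingHom.id_apply, Algebra.smul_def, Algebra.smul_def, map_mul]
          congr 1
          exact galInfiniteCompletionMap_completionMap F c v (i₁ := i) (i₂ := i) hcw a }
    -- its fixed subspace
    let W : Submodule v.Completion w.Completion := LinearMap.ker (f - LinearMap.id)
    have hmemW : ∀ z, z ∈ W ↔ galInfiniteCompletionMap c hcw z = z := fun z => by
      simp only [W, LinearMap.mem_ker, LinearMap.sub_apply, LinearMap.id_apply, sub_eq_zero]
      rfl
    have h1W : (1 : w.Completion) ∈ W := (hmemW 1).mpr (map_one _)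
    have hyW : y ∈ W := (hmemW y).mpr (hy c hcw)
    -- `W ≠ ⊤`: `c_w` moves a preimage of `i`
    have hWtop : W ≠ ⊤ := by
      intro htop
      have hcx : w.IsComplex := (isRamified_iff.mp hram).1
      obtain ⟨z, hz⟩ := Completion.surjective_extensionEmbedding_of_isComplex hcx Complex.I
      have hzW : z ∈ W := htop ▸ Submodule.mem_top
      have h' := congrArg (Completion.extensionEmbedding w) ((hmemW z).mp hzW)
      rw [extensionEmbedding_galInfiniteCompletionMap_of_ne_one hcw hc1, hz, Complex.conj_I] at h'
      exact Complex.I_ne_zero (by linear_combination (-1 : ℂ) * h' / 2)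
    -- hence `finrank W ≤ 1`, and `W = span {1}`
    have hWlt : Module.finrank v.Completion W < 2 := by
      rw [← h2]; exact Submodule.finrank_lt hWtop
    have hspan : Submodule.span v.Completion {(1 : w.Completion)} = W := by
      apply Submodule.eq_of_le_of_finrank_le
      · rw [Submodule.span_le, Set.singleton_subset_iff]; exact h1W
      · have : Module.finrank v.Completion (Submodule.span v.Completion {(1 : w.Completion)}) = 1 :=
          finrank_span_singleton one_ne_zero
        omega
    rw [← hspan, Submodule.mem_span_singleton] at hyW
    obtain ⟨a, ha⟩ := hyW
    exact ⟨a, by rw [← ha, Algebra.smul_def, mul_one]; rfl⟩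

end ArchHerbrand

/-! ### Galois descent for ideles: `J_E^G = J_F` -/

namespace IdeleHerbrand

open Literature.NumberTheory.Automorphic NumberField.InfinitePlace
open scoped NumberField.LiesOver

variable {F : Type u} [Field F] [NumberField F] {E : Type u} [Field E] [NumberField E] [Algebra F E]

/-- `a ^ n = 1 ↔ a = 1` (`n ≠ 0`) in the value group `ℤₘ₀`. [folklore] -/
theorem pow_eq_one_iff_of_ne_zero' {a : WithZero (Multiplicative ℤ)} {n : ℕ} (hn : n ≠ 0) :
    a ^ n = 1 ↔ a = 1 := by
  refine ⟨fun h => le_antisymm ?_ ?_, fun h => by rw [h, one_pow]⟩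
  · exact (pow_le_one_iff hn).mp h.le
  · exact (one_le_pow_iff hn).mp h.ge

variable [IsGalois F E]

/-- **Galois descent `J_E^G = J_F`**: an idele of `E` fixed by `Gal(E/F)` is the base change of an
idele of `F`. [cite: CasselsFrohlichANT1967, Ch. VII §1.1; Childress2009, Ch. 4 §5 (PDF p. 102)] -/
theorem exists_ideleBaseChange_eq_of_forall_smul_eq (x : ideleGroup E) (hx : ∀ σ : E ≃ₐ[F] E, σ • x = x) :
    ∃ y : ideleGroup F, AdeleRing.ideleBaseChange F E y = x := by
  classical
  haveI : FiniteDimensional F E := Module.Finite.of_restrictScalars_finite ℚ F E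
  -- finite places: blockwise descent
  have hfin : ∀ v : HeightOneSpectrum (𝓞 F), ∃ c : v.adicCompletion F,
      algebraMap (v.adicCompletion F) (SemiLocal F E v) c = (blockHom F E v x : (SemiLocal F E v)ˣ) :=
    fun v => SemiLocal.exists_eq_algebraMap_of_forall_smul_eq _ fun σ => by
      rw [← SemiLocal.val_smul_units, ← blockHom_smul, hx σ]
  choose c hc using hfin
  haveI hli : ∀ w : HeightOneSpectrum (𝓞 E), w.asIdeal.LiesOver (w.under (𝓞 F)).asIdeal := fun w => ⟨rfl⟩
  have hcw : ∀ w : HeightOneSpectrum (𝓞 E),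
      (x : AdeleRing (𝓞 E) E).2 w = adicCompletionOfLiesOver F E (w.under (𝓞 F)) w (c (w.under (𝓞 F))) := by
    intro w
    have := congrFun (hc (w.under (𝓞 F))) ⟨w, rfl⟩
    rw [SemiLocal.algebraMap_apply] at this
    exact this.symm
  have he : ∀ w : HeightOneSpectrum (𝓞 E), (w.under (𝓞 F)).asIdeal.ramificationIdx' w.asIdeal ≠ 0 := fun w =>
    Ideal.IsDedekindDomain.ramificationIdx'_ne_zero_of_liesOver w.asIdeal (w.under (𝓞 F)).ne_bot
  have hval : ∀ w : HeightOneSpectrum (𝓞 E), Valued.v ((x : AdeleRing (𝓞 E) E).2 w) =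
      Valued.v (c (w.under (𝓞 F))) ^ (w.under (𝓞 F)).asIdeal.ramificationIdx' w.asIdeal := fun w => by
    rw [hcw w, valued_adicCompletionOfLiesOver]
  have hc0 : ∀ v, c v ≠ 0 := fun v h0 => by
    obtain ⟨w⟩ := (inferInstance : Nonempty (SemiLocal.Place F E v))
    have := congrFun (hc v) w
    rw [h0, map_zero, blockHom_apply] at this
    exact snd_apply_ne_zero x _ this.symm
  have hcfin : ∀ᶠ v : HeightOneSpectrum (𝓞 F) in Filter.cofinite, Valued.v (c v) = 1 := by
    have hx1 : ∀ᶠ w : HeightOneSpectrum (𝓞 E) in Filter.cofinite,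
        Valued.v ((x : AdeleRing (𝓞 E) E).2 w) = 1 := by
      have hu : IsUnit (x : AdeleRing (𝓞 E) E).2 := (Prod.isUnit_iff.mp x.isUnit).2
      exact (FiniteAdeleRing.isUnit_iff.mp hu).2
    rw [Filter.eventually_cofinite] at hx1 ⊢
    refine (hx1.image fun w : HeightOneSpectrum (𝓞 E) => w.under (𝓞 F)).subset fun v hv => ?_
    obtain ⟨w⟩ := (inferInstance : Nonempty (SemiLocal.Place F E v))
    refine ⟨(w : HeightOneSpectrum (𝓞 E)), fun hw => hv ?_, w.under_eq⟩
    have h := hval w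
    rw [hw] at h
    have := (pow_eq_one_iff_of_ne_zero' (he w)).mp h.symm
    rwa [w.under_eq] at this
  -- infinite places: descent at a chosen place above `v`, transported along the orbit
  have hinf : ∀ v : InfinitePlace F, ∃ c : v.Completion, ∀ (w : InfinitePlace E) (hw : ArchHerbrand.IsOver E v w),
      (x : AdeleRing (𝓞 E) E).1 w =
        @NumberField.LiesOver.completionMap F E _ _ _ v w ⟨congrArg Subtype.val hw⟩ c := by
    intro v
    set w₀ := ArchHerbrand.placeOver E v with hw₀def
    have hw₀ : ArchHerbrand.IsOver E v w₀ := ArchHerbrand.isOver_placeOver v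
    haveI i₀ : w₀.1.LiesOver v.1 := ⟨congrArg Subtype.val hw₀⟩
    obtain ⟨c, hc⟩ := ArchHerbrand.exists_eq_completionMap_of_forall_smul_eq (F := F) v w₀
      ((x : AdeleRing (𝓞 E) E).1 w₀) fun σ h => by
        have hx' := congrArg (fun u : ideleGroup E => (u : AdeleRing (𝓞 E) E).1 w₀) (hx σ)
        simp only [fst_smul, InfiniteAdeleRing.smul_apply] at hx'
        rwa [galInfiniteCompletionMap_apply_congr_place F (InfinitePlace.inv_smul_eq_of_smul_eq h) _ h
          (x : AdeleRing (𝓞 E) E).1] at hx'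
    refine ⟨c, fun w hw => ?_⟩
    obtain ⟨g, hg⟩ := ArchHerbrand.exists_smul_eq_of_isOver hw₀ hw
    haveI i : w.1.LiesOver v.1 := ⟨congrArg Subtype.val hw⟩
    have hx' := congrArg (fun u : ideleGroup E => (u : AdeleRing (𝓞 E) E).1 w) (hx g)
    simp only [fst_smul, InfiniteAdeleRing.smul_apply] at hx'
    rw [galInfiniteCompletionMap_apply_congr_place F (InfinitePlace.inv_smul_eq_of_smul_eq hg) _ hg
      (x : AdeleRing (𝓞 E) E).1, ← hc, galInfiniteCompletionMap_completionMap F g v (i₁ := i₀) (i₂ := i) hg c] at hx'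
    exact hx'.symm
  choose d hd using hinf
  have hd0 : ∀ v, d v ≠ 0 := fun v h0 => by
    have := hd v (ArchHerbrand.placeOver E v) (ArchHerbrand.isOver_placeOver v)
    rw [h0, map_zero] at this
    exact ArchHerbrand.apply_ne_zero (infHom E x) _ this
  -- the idele of `F`
  set yf : FiniteAdeleRing (𝓞 F) F := RestrictedProduct.mk (fun v => c v)
    (hcfin.mono fun v hv => (HeightOneSpectrum.mem_adicCompletionIntegers _ _ _).mpr hv.le) with hyf
  have hyfu : IsUnit yf := FiniteAdeleRing.isUnit_iff.mpr ⟨hc0, hcfin⟩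
  have hyiu : IsUnit (fun v => d v : InfiniteAdeleRing F) := ArchHerbrand.isUnit_of_forall_ne_zero hd0
  have hyu : IsUnit ((fun v => d v, yf) : AdeleRing (𝓞 F) F) := Prod.isUnit_iff.mpr ⟨hyiu, hyfu⟩
  refine ⟨hyu.unit, Units.ext ?_⟩
  rw [AdeleRing.coe_ideleBaseChange, IsUnit.unit_spec]
  refine Prod.ext (funext fun w => ?_) (FiniteAdeleRing.ext E fun w => ?_)
  · rw [AdeleRing.baseChange_fst, InfiniteAdeleRing.baseChange_apply]
    haveI i : w.1.LiesOver (w.comap (algebraMap F E)).1 := ⟨rfl⟩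
    rw [infiniteCompletionOfComap_eq F w (i := i) rfl (fun v => d v)]
    exact (hd _ w rfl).symm
  · rw [AdeleRing.baseChange_snd, FiniteAdeleRing.baseChange_apply]
    rw [show (yf : FiniteAdeleRing (𝓞 F) F) (w.under (𝓞 F)) = (fun v => c v) (w.under (𝓞 F)) from rfl,
      adicCompletionOfUnder_eq F w (i := hli w) rfl (fun v => c v)]
    exact (hcw w).symm

/-! ### Hilbert 90 for idele classes -/

variable (E) in
/-- The principal idele map `Eˣ →* J_E`. [folklore] -/
def principal : Eˣ →* ideleGroup E := Units.map (algebraMap E (AdeleRing (𝓞 E) E)).toMonoidHom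

omit [NumberField F] [IsGalois F E] in
/-- `principal` is `Gal(E/F)`-equivariant (`σ • (k)_𝔸 = (σ k)_𝔸`). [cite: CasselsFrohlichANT1967, Ch. VII §1.1] -/
theorem principal_smul (σ : E ≃ₐ[F] E) (k : Eˣ) : principal E (σ • k) = σ • principal E k :=
  Units.ext (AdeleRing.smul_algebraMap F σ (k : E)).symm

omit [NumberField F] [Algebra F E] [IsGalois F E] in
/-- `principal` is injective. [folklore] -/
theorem principal_injective : Function.Injective (principal E) :=
  Units.map_injective (AdeleRing.algebraMap_injective (𝓞 E) E)

omit [NumberField F] [Algebra F E] [IsGalois F E] in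
/-- The range of `principal` is the subgroup of principal ideles. [folklore] -/
theorem range_principal : (principal E).range = principalIdeles E := rfl

omit [NumberField F] [NumberField E] [IsGalois F E] in
/-- The norm of the Herbrand calculus on `Eˣ` is `CyclicNormIndex.normEnd σ #G`. [folklore] -/
theorem norm_units_eq_normEnd [FiniteDimensional F E] {σ : E ≃ₐ[F] E}
    (hσ : ∀ τ : E ≃ₐ[F] E, τ ∈ Subgroup.zpowers σ) (k : Eˣ) :
    Herbrand.norm (E ≃ₐ[F] E) k = CyclicNormIndex.normEnd σ (Nat.card (E ≃ₐ[F] E)) k := by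
  rw [Herbrand.norm_apply, CyclicNormIndex.normEnd_apply,
    CyclicNormIndex.prod_range_card_pow_eq_prod hσ (fun g => g • k)]

/-- **Hilbert 90 for idele classes**: `{x ∈ J_E : σx/x ∈ Eˣ} = J_F · Eˣ` for `Gal(E/F) = ⟨σ⟩`
cyclic: if `σx/x = (k)` then `N k = 1`, so `k = σb/b` (Hilbert 90) and `x/(b)` is `G`-fixed, hence
in `J_F` (descent). [cite: Childress2009, Ch. 4 §5 proof of Thm. 5.11 (PDF p. 102)] -/
theorem z0_top_principalIdeles_eq [FiniteDimensional F E] {σ : E ≃ₐ[F] E}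
    (hσ : ∀ τ : E ≃ₐ[F] E, τ ∈ Subgroup.zpowers σ) :
    Herbrand.z0 σ (⊤ : Subgroup (ideleGroup E)) (principalIdeles E) =
      (AdeleRing.ideleBaseChange F E).range ⊔ principalIdeles E := by
  apply le_antisymm
  · intro x hx
    obtain ⟨-, k, hk⟩ := Herbrand.mem_z0.mp hx
    -- `N k = 1`
    have hN : Herbrand.norm (E ≃ₐ[F] E) (principal E k) = 1 := by
      rw [show principal E k = σ • x / x from hk, map_div, Herbrand.norm_smul, div_self']
    have hNk : CyclicNormIndex.normEnd σ (Nat.card (E ≃ₐ[F] E)) k = 1 := by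
      rw [← norm_units_eq_normEnd hσ]
      apply principal_injective
      rw [map_one, Herbrand.map_norm_eq (principal E) (fun g y => principal_smul g y) k, hN]
    obtain ⟨b, hb⟩ := CyclicNormIndex.exists_smul_div_eq_of_normEnd_eq_one hσ hNk
    -- `x / (b)` is fixed
    have hfix : σ • (x / principal E b) = x / principal E b := by
      have hk' : σ • x = x * principal E k := by
        rw [show principal E k = σ • x / x from hk, mul_div_cancel]
      rw [smul_div', ← principal_smul, hk', ← hb, map_div, principal_smul]
      rw [mul_div_assoc', div_div, mul_comm (principal E b), ← div_div, mul_div_cancel_right]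
    have hfix' : ∀ g : E ≃ₐ[F] E, g • (x / principal E b) = x / principal E b :=
      (Herbrand.forall_smul_eq_iff hσ).mpr hfix
    obtain ⟨y, hy⟩ := exists_ideleBaseChange_eq_of_forall_smul_eq _ hfix'
    have : x = AdeleRing.ideleBaseChange F E y * principal E b := by rw [hy, div_mul_cancel]
    rw [this]
    exact Subgroup.mul_mem _ (Subgroup.mem_sup_left ⟨y, rfl⟩) (Subgroup.mem_sup_right ⟨b, rfl⟩)
  · refine sup_le ?_ ?_
    · rintro _ ⟨y, rfl⟩
      refine Herbrand.mem_z0.mpr ⟨Subgroup.mem_top _, ?_⟩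
      rw [AdeleRing.smul_ideleBaseChange, div_self']
      exact Subgroup.one_mem _
    · intro p hp
      exact Herbrand.mem_z0.mpr ⟨Subgroup.mem_top _, isStable_principalIdeles.twist_mem σ hp⟩

/-! ### `#Ĥ⁰(G; J_E, Eˣ) = [J_F : Fˣ N J_E]` -/

omit [NumberField F] [IsGalois F E] in
/-- The norm of the Herbrand calculus on `J_E` is `AdeleRing.ideleGalNorm`. [folklore] -/
theorem norm_eq_ideleGalNorm [FiniteDimensional F E] (y : ideleGroup E) :
    Herbrand.norm (E ≃ₐ[F] E) y = AdeleRing.ideleGalNorm F E y := by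
  rw [Herbrand.norm_apply]; rfl

/-- **The preimage of `Eˣ · N J_E` under `J_F → J_E` is the norm group `Fˣ · N_{E/F} J_E`**
(a `G`-fixed principal idele is principal from `F`, by Galois theory).
[cite: Childress2009, Ch. 4 §5 proof of Thm. 5.11 (PDF p. 102)] -/
theorem comap_b0_eq_normGroup [FiniteDimensional F E] :
    (Herbrand.b0 (E ≃ₐ[F] E) (⊤ : Subgroup (ideleGroup E)) (principalIdeles E)).comap
      (AdeleRing.ideleBaseChange F E) = normGroup F E := by
  apply le_antisymm
  · intro y hy
    obtain ⟨p, ⟨k, rfl⟩, z, -, hpz⟩ := Herbrand.mem_b0.mp hy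
    -- the principal part is fixed, hence from `F`
    have hfix : ∀ g : E ≃ₐ[F] E, g • principal E k = principal E k := fun g => by
      have : principal E k = AdeleRing.ideleBaseChange F E y / Herbrand.norm (E ≃ₐ[F] E) z := by
        rw [← hpz]; exact (mul_div_cancel_right _ _).symm
      rw [this, smul_div', AdeleRing.smul_ideleBaseChange, Herbrand.smul_norm]
    have hk : ∀ g : E ≃ₐ[F] E, g (k : E) = k := fun g => by
      have := hfix g
      rw [← principal_smul] at this
      exact congrArg (fun u : Eˣ => (u : E)) (principal_injective this)
    obtain ⟨a, ha⟩ := (IsGalois.mem_range_algebraMap_iff_fixed (k : E)).mpr hk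
    have ha0 : a ≠ 0 := fun h0 => k.ne_zero (by rw [← ha, h0, map_zero])
    set a' : Fˣ := Units.mk0 a ha0
    have hpa : principal E k = AdeleRing.ideleBaseChange F E
        (Units.map (algebraMap F (AdeleRing (𝓞 F) F)).toMonoidHom a') := by
      apply Units.ext
      show algebraMap E (AdeleRing (𝓞 E) E) (k : E) = AdeleRing.baseChange F E (algebraMap F (AdeleRing (𝓞 F) F) a)
      rw [AdeleRing.baseChange_algebraMap, ← ha]
    -- conclude
    have hnorm : y / Units.map (algebraMap F (AdeleRing (𝓞 F) F)).toMonoidHom a' ∈ idelicNormSubgroup F E := by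
      refine mem_idelicNormSubgroup_iff.mpr ⟨z, ?_⟩
      rw [map_div, ← hpa, ← hpz, ← norm_eq_ideleGalNorm]
      show Herbrand.norm (E ≃ₐ[F] E) z = principal E k * Herbrand.norm (E ≃ₐ[F] E) z / principal E k
      rw [mul_div_cancel_left]
    have : y = Units.map (algebraMap F (AdeleRing (𝓞 F) F)).toMonoidHom a' *
        (y / Units.map (algebraMap F (AdeleRing (𝓞 F) F)).toMonoidHom a') := by rw [mul_div_cancel]
    rw [this]
    exact Subgroup.mul_mem _ (Subgroup.mem_sup_left ⟨a', rfl⟩) (Subgroup.mem_sup_right hnorm)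
  · refine sup_le ?_ ?_
    · rintro _ ⟨a, rfl⟩
      refine Herbrand.le_b0 (C := principalIdeles E) ⟨Units.map (algebraMap F E : F →* E) a, Units.ext ?_⟩
      show algebraMap E (AdeleRing (𝓞 E) E) (algebraMap F E a) =
        AdeleRing.baseChange F E (algebraMap F (AdeleRing (𝓞 F) F) a)
      rw [AdeleRing.baseChange_algebraMap]
    · intro y hy
      obtain ⟨z, hz⟩ := mem_idelicNormSubgroup_iff.mp hy
      refine Herbrand.mem_b0.mpr ⟨1, Subgroup.one_mem _, z, Subgroup.mem_top _, ?_⟩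
      rw [one_mul, norm_eq_ideleGalNorm, hz]

omit [NumberField F] [NumberField E] [Algebra F E] [IsGalois F E] in
/-- `[Z · P : B] = [Z : B]` for `P ≤ B` (relative indices, commutative group). [folklore] -/
theorem relIndex_sup_eq_of_le {M : Type*} [CommGroup M] {B Z P : Subgroup M} (hP : P ≤ B) :
    B.relIndex (Z ⊔ P) = B.relIndex Z := by
  have hmod : B ⊓ (Z ⊔ P) = (B ⊓ Z) ⊔ P := by
    apply le_antisymm
    · rintro x ⟨hxB, hxZP⟩
      obtain ⟨z, hz, p, hp, rfl⟩ := Subgroup.mem_sup.mp hxZP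
      have hzB : z ∈ B := by
        have := B.mul_mem hxB (B.inv_mem (hP hp))
        rwa [mul_inv_cancel_right] at this
      exact Subgroup.mem_sup.mpr ⟨z, ⟨hzB, hz⟩, p, hp, rfl⟩
    · exact sup_le (inf_le_inf_left _ le_sup_left) (le_inf hP le_sup_right)
  rw [← Subgroup.inf_relIndex_right B (Z ⊔ P), hmod,
    Herbrand.relIndex_sup_sup_eq (inf_le_right : B ⊓ Z ≤ Z) (le_inf (inf_le_right.trans hP) inf_le_left),
    Subgroup.inf_relIndex_right]

/-- **`#Ĥ⁰(G; J_E, Eˣ) = [J_F : Fˣ N_{E/F} J_E]`** for `Gal(E/F) = ⟨σ⟩` cyclic.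
[cite: Childress2009, Ch. 4 §5 proof of Thm. 5.11 (PDF p. 102)] -/
theorem h0_top_principalIdeles_eq_index_normGroup [FiniteDimensional F E] {σ : E ≃ₐ[F] E}
    (hσ : ∀ τ : E ≃ₐ[F] E, τ ∈ Subgroup.zpowers σ) :
    Herbrand.h0 σ (⊤ : Subgroup (ideleGroup E)) (principalIdeles E) = (normGroup F E).index := by
  rw [Herbrand.h0_def, z0_top_principalIdeles_eq hσ, relIndex_sup_eq_of_le Herbrand.le_b0,
    ← comap_b0_eq_normGroup, Subgroup.index_comap]

/-- **The idelic global cyclic norm index identity (Childress Thm. 5.11 ⇒ first inequality).**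
Let `E/F` be a cyclic extension of number fields, `Gal(E/F) = ⟨σ⟩` of order `n`.  Under the
hypotheses `hun₀`, `hun₁` (Prop. 5.7 (iii): local units outside a finite set `S` have trivial
`Ĥ⁰`, `Ĥ⁻¹`) and `hunits`, `hunits'` (Prop. 5.10 for the global units), the norm group
`Fˣ N_{E/F} J_E ≤ J_F` has finite index divisible by `n`; in particular
`[J_F : Fˣ N_{E/F} J_E] ≥ [E : F]`. [cite: Childress2009, Ch. 4 §5 Thm. 5.11–5.12 (PDF pp. 101–103)] -/
theorem card_dvd_index_normGroup [FiniteDimensional F E] {σ : E ≃ₐ[F] E}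
    (hσ : ∀ τ : E ≃ₐ[F] E, τ ∈ Subgroup.zpowers σ) (S : Finset (HeightOneSpectrum (𝓞 F)))
    (hun₀ : ∀ v ∉ S, ∀ z ∈ SemiLocal.unitGroup F E v, (∀ g : E ≃ₐ[F] E, g • z = z) →
      ∃ y ∈ SemiLocal.unitGroup F E v, Herbrand.norm (E ≃ₐ[F] E) y = z)
    (hun₁ : ∀ v ∉ S, ∀ z ∈ SemiLocal.unitGroup F E v, Herbrand.norm (E ≃ₐ[F] E) z = 1 →
      ∃ y ∈ SemiLocal.unitGroup F E v, Herbrand.twist σ y = z)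
    (hunits : Fintype.card (E ≃ₐ[F] E) * Herbrand.h0 σ (unitIdeles E ⊓ principalIdeles E) ⊥ =
      ArchHerbrand.archFactor F E * Herbrand.h1 σ (unitIdeles E ⊓ principalIdeles E) ⊥)
    (hunits' : Herbrand.h1 σ (unitIdeles E ⊓ principalIdeles E) ⊥ ≠ 0) :
    Fintype.card (E ≃ₐ[F] E) ∣ (normGroup F E).index ∧ (normGroup F E).index ≠ 0 := by
  obtain ⟨h0, h1⟩ := h0_top_principalIdeles_eq hσ S hun₀ hun₁ hunits hunits'
  rw [h0_top_principalIdeles_eq_index_normGroup hσ] at h0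
  exact ⟨⟨_, h0⟩, by rw [h0]; exact mul_ne_zero Fintype.card_ne_zero h1⟩

end IdeleHerbrand

end Literature.NumberTheory.GaloisRepresentations
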